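/-
Origin: expansion seat `planner-pub-hodgecm-mc-theta-3-g13-0`, handover (K12) 2026-08-20T11:09:21Z md5 c8c4d18086f20752d254611ec4799b62 (311 l., 13 theorems; NEW additive drop-alone leaf over RUN-48 (K10) `ArchSlotDeltaDischarge23` + RUN-38 `HypCensus/OmgInsIotaChoice`; (J-μ) W-pin torus identity hμ theta side: slotTypeVec k = boxType_k, dIotaAt = slotPlaceScalar, η·χ_T·dIotaAt = archWeight (μ♯♯ c 0) u₀ · archWeight (μ♯♯ c 1) u₁ at the OG pin; sha256 918050db9ab3) (`HOME/mc/pub-hodgecm-mc-theta-3-g13/lean/stage50/HodgeCM/Model/ArchPinTorusIdentity.lean`, md5 c8c4d18086f2, 311 lines);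
landed by the second packager p2 gen 7 (p2-g7) in gate run 50 as `HodgeCM/Model/ArchPinTorusIdentity.lean` (verbatim).
-/
/-
Origin: speedrun cell pub-hodgecm, MODEL-CONSTRUCTION sub-cell, lineage mc-theta-3 (theta supply / second-lift lane, BINDER-OWNERS row 5 `S` slot),
seat planner-pub-hodgecm-mc-theta-3-g13-0 (gen 13), 2026-08-20.  Target in PKG: `HodgeCM/Model/ArchPinTorusIdentity.lean`
(NEW additive drop-alone leaf; imports this seat's RUN-48 (K10) `Model/ArchSlotDeltaDischarge23` (over (TD), (BT), sinst-1's `ThetaAdelicSideReadOff`) and binder-2's RUN-38 `Model/HypCensus/OmgInsIotaChoice` (`dIotaAt`)).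
KERNEL only: 0 records / Prop-valued definitions / cites, 0 proof holes; intended closure {propext, Classical.choice, Quot.sound}.
-/
import Summits.HodgeConjecture.HodgeCM.Model.ArchSlotDeltaDischarge23
import Summits.HodgeConjecture.HodgeCM.Model.HypCensus.OmgInsIotaChoice

/-!
# (J-μ) AT THE W PIN: the absolute slot types and binder-2's torus identity `hμ`, theta side

binder-2's census closes E's rows 17/18/19 at the W pin of record modulo ONE scalar identity on the archimedean torus
(`HypCensus/OmgInsPinChoice.omgW_ins_vacuum_datumAt_eq_of_weight`, (T12) d2 `OmgInsAll.omgW_ins_eq_of_weight`):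
`hμ : ∀ t, η(1, diag(u_t)_𝔸) · χ_T(u_t) · dIotaAt(u_t) = (printed weight at t)⁻¹`, `χ_T = pinTorusChar V S hGR h₁W`.
At the Stage-B η of record `η = EtaChi.η χV χW` (sinst-1 `ThetaAdelicSideEta`; the W character `χW = χWR` has type `μ c 0 − slotTypeVec … 0`
by `ThetaAdelicSideReadOff.archType_χOfType_nW`) every factor of the left-hand side is a typed weight of the torus coordinates, and this
leaf computes their product in closed form from two theta-side facts:

* §1 **the ABSOLUTE slot types of the plane** (`slotTypeVec_zero_eq_boxType₀`, `slotTypeVec_one_eq_boxType₁`): `slotTypeVec … k = boxType_k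
  = pinTorusType_k + 𝟙_{w(v₁)}` for `k = 0, 1` — (BT) proved only the difference (`slotTypeVec_one_sub_zero_eq`); the absolute read-off is
  sinst-1's #1214 `slotType_eq_of_arch_eigen` at (BT)'s eigen-identity `ctxSlotArchBox_harch`;
* §2 **binder-2's `ι₁` scalar is the slot place scalar** (`dIotaAt_eq_slotPlaceScalar`: `dIotaAt u = slotPlaceScalar u`, the plane reading
  positive by `hpos₀ hpos₁`, `cmXW_cmPlace_pos`) and **the torus identity in typed-weight form** (`archWeight_pin_identity`): for all `n`, `t₀ t₁`,
  `archWeight (n − slotTypeVec 0) t₀ · archWeight (n − slotTypeVec 0) t₁ · χ_T(t₀,t₁) · slotPlaceScalar (t₀,t₁)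
     = archWeight n t₀ · archWeight (n + (slotTypeVec 1 − slotTypeVec 0)) t₁`
  (`slotPlaceScalar (t₀,t₁) = ι_{w(v₁)}(t₀) ι_{w(v₁)}(t₁)`, (BT) `slotPlaceScalar_mk`);
* §3 **the η-factor at binder-2's torus element** (`eta_archProdHom_one_archDiag`): at the Stage-B η,
  `η (archProdHom (1, archDiag (dW c.D) (t₀,t₁))) = χW[t₀] · χW[t₁] = archWeight (archType χW) t₀ · archWeight (archType χW) t₁`, hence
  (`eta_pinTorusChar_slotPlaceScalar`) for a W character of type `n − slotTypeVec … 0`: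
  `η(1, diag(t₀,t₁)) · χ_T(t₀,t₁) · slotPlaceScalar(t₀,t₁) = archWeight n t₀ · archWeight (n + (slotTypeVec 1 − slotTypeVec 0)) t₁`.

* §4 **at E's pin of record** (OG guard `SInstance.GOG`, `χW := SInstance.χWR … (μ♯♯)`, `μ♯♯ = muSharp₂₃ μ` of (K10); `n = μ♯♯ c 0 = μ c 0` and
  (TD)/(K10) `hΔ₁_GOG_muSharp₂₃`): `eta_pinTorusChar_dIotaAt_GOG` — for every guarded `(V, c)` and every `u ∈ T(L⁺ ⊗ ℝ)`,
  `η(1, diag u) · χ_T(u) · dIotaAt u = archWeight (μ♯♯ c 0) u₀ · archWeight (μ♯♯ c 1) u₁`,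
  the inverse of a printed torus weight with exponents `−μ♯♯ c 0`, `−μ♯♯ c 1` (glue-1's #398S prints `fun w => -(μ♯♯) c 0 w`, `fun w => -(μ♯♯) c 1 w`).

So at `u := archOf … t` binder-2's `hμ` reads `archWeight (μ♯♯ c 0) (fst u) · archWeight (μ♯♯ c 1) (snd u) = (printPlacesW … t)⁻¹` — its printed
side only (`printPlacesW`, `cAt_archOf`), no theta-kernel term left in it.  Nothing here is a claim of PerL/QW8; nothing is cited as a fact.
-/

set_option autoImplicit false

noncomputable section

open scoped Matrix Classical
open NumberField (InfinitePlace maximalRealSubfield IsCMField)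
open NumberField.mixedEmbedding (mixedSpace)
open Literature.NumberTheory.Automorphic Literature.NumberTheory.Automorphic.UnitaryGroup
open Literature.NumberTheory.GelbartRogawski1991 Literature.NumberTheory.GelbartRogawski1991.UnitaryDualPair
open HodgeCM.Adelic HodgeCM.PerL34 HodgeCM.Model.HypCensus

namespace HodgeCM.Model.ArchSideTerm

section Pin

variable {L : CMField} {ι₁ : L →+* ℂ} (V : HermSpace3 L ι₁) (c : SeesawCtx L)
variable
  (hGR : (cmSplittingDatum (L : Type) finProdFinEquiv (frameD V) (frameD_real V) (frameD_ne V) (dW c.D) (dW_real c.D) (dW_ne c.D)).CompatibleSplitting)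
  (hGR₀ : (cmSplittingDatum (L : Type) (e₁) (frameD V) (frameD_real V) (frameD_ne V) (lineVec (L : Type) (dW c.D 0))
    (fun _ => dW_real c.D 0) (fun _ => dW_ne c.D 0)).CompatibleSplitting)
  (hGR₁ : (cmSplittingDatum (L : Type) (e₁) (frameD V) (frameD_real V) (frameD_ne V) (lineVec (L : Type) (dW c.D 1))
    (fun _ => dW_real c.D 1) (fun _ => dW_ne c.D 1)).CompatibleSplitting)
  (hGR₂ : (cmSplittingDatum (L : Type) (e₁) (frameD V) (frameD_real V) (frameD_ne V) (lineVec (L : Type) (dW' c.D 0))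
    (fun _ => dW'_real c.D 0) (fun _ => dW'_ne c.D 0)).CompatibleSplitting)
  (hGR₃ : (cmSplittingDatum (L : Type) (e₁) (frameD V) (frameD_real V) (frameD_ne V) (lineVec (L : Type) (dW' c.D 1))
    (fun _ => dW'_real c.D 1) (fun _ => dW'_ne c.D 1)).CompatibleSplitting)
  (h₁W : (∀ j, 0 < (ι₁ (dW c.D j)).re) ∨ ∀ j, (ι₁ (dW c.D j)).re < 0)
  (hpos₀ : 0 < cmXW (L : Type) (frameD V) (lineVec (L : Type) (dW c.D 0)) (fun _ => dW_real c.D 0) ι₁ (HypCensus.cmPlace (L : Type) ι₁) 0)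
  (hpos₁ : 0 < cmXW (L : Type) (frameD V) (lineVec (L : Type) (dW c.D 1)) (fun _ => dW_real c.D 1) ι₁ (HypCensus.cmPlace (L : Type) ι₁) 0)

/-! ## §1 the absolute slot types of the plane -/

include hpos₀ hpos₁ in
/-- both plane slot types, read off (BT)'s eigen-identity `ctxSlotArchBox_harch` by sinst-1's #1214 `slotType_eq_of_arch_eigen`. -/
theorem slotTypeVec_zero_one_eq_boxType :
    slotTypeVec V c hGR hGR₀ hGR₁ hGR₂ hGR₃ h₁W 0 = boxType₀ V c.D hGR h₁W ∧
      slotTypeVec V c hGR hGR₀ hGR₁ hGR₂ hGR₃ h₁W 1 = boxType₁ V c.D hGR h₁W :=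
  slotType_eq_of_arch_eigen V c.D hGR hGR₀ hGR₁
    (linePhi V (dW c.D 0) (dW_real c.D 0) (dW_ne c.D 0) hpos₀) (linePhi V (dW c.D 1) (dW_real c.D 1) (dW_ne c.D 1) hpos₁)
    (lineX₀ V (dW c.D 0) (dW_real c.D 0) (dW_ne c.D 0) hpos₀) (lineX₀ V (dW c.D 1) (dW_real c.D 1) (dW_ne c.D 1) hpos₁)
    (lineCHom V (dW c.D 0) (dW_real c.D 0) (dW_ne c.D 0) hGR₀) (lineCHom V (dW c.D 1) (dW_real c.D 1) (dW_ne c.D 1) hGR₁)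
    (fun N t => line_hctr V (dW c.D 0) (dW_real c.D 0) (dW_ne c.D 0) hGR₀ hpos₀ _ N t)
    (fun N t => line_hctr V (dW c.D 1) (dW_real c.D 1) (dW_ne c.D 1) hGR₁ hpos₁ _ N t)
    (continuous_slotChi₀_mul_lineCHom V c.D hGR hGR₀ hGR₁ h₁W) (continuous_slotChi₁_mul_lineCHom V c.D hGR hGR₀ hGR₁ h₁W)
    (linePhi_archEmb_lineX₀_ne_zero V _ _ _ hpos₀) (linePhi_archEmb_lineX₀_ne_zero V _ _ _ hpos₁) one_ne_zero
    (boxType₀ V c.D hGR h₁W) (boxType₁ V c.D hGR h₁W) (ctxSlotArchBox_harch V c hGR h₁W hpos₀ hpos₁)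

include hpos₀ hpos₁ in
/-- **THE ABSOLUTE TYPE OF SLOT 0**: `slotTypeVec … 0 = boxType₀ = pinTorusType₀ + 𝟙_{w(v₁)}`. -/
theorem slotTypeVec_zero_eq_boxType₀ :
    slotTypeVec V c hGR hGR₀ hGR₁ hGR₂ hGR₃ h₁W 0 = boxType₀ V c.D hGR h₁W :=
  (slotTypeVec_zero_one_eq_boxType V c hGR hGR₀ hGR₁ hGR₂ hGR₃ h₁W hpos₀ hpos₁).1

include hpos₀ hpos₁ in
/-- **THE ABSOLUTE TYPE OF SLOT 1**: `slotTypeVec … 1 = boxType₁ = pinTorusType₁ + 𝟙_{w(v₁)}`. -/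
theorem slotTypeVec_one_eq_boxType₁ :
    slotTypeVec V c hGR hGR₀ hGR₁ hGR₂ hGR₃ h₁W 1 = boxType₁ V c.D hGR h₁W :=
  (slotTypeVec_zero_one_eq_boxType V c hGR hGR₀ hGR₁ hGR₂ hGR₃ h₁W hpos₀ hpos₁).2

/-! ## §2 binder-2's torus identity in typed-weight form -/

/-- `χ_T(t₀,t₁) · slotPlaceScalar (t₀,t₁) = archWeight boxType₀ t₀ · archWeight boxType₁ t₁` ((BT) §3, restated on the scalar). -/
theorem pinTorusChar_mul_slotPlaceScalar (t₀ t₁ : ↥(relNormOneInfUnits (↥(maximalRealSubfield (L : Type))) (L : Type))) :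
    ((pinTorusChar V c.D hGR h₁W (NumberField.SeesawArchTorus.mk (L : Type) t₀ t₁) : Circle) : ℂ) *
        slotPlaceScalar (ι₁ := ι₁) (NumberField.SeesawArchTorus.mk (L : Type) t₀ t₁) =
      archWeight (L : Type) (boxType₀ V c.D hGR h₁W) t₀ * archWeight (L : Type) (boxType₁ V c.D hGR h₁W) t₁ := by
  rw [pinTorusChar_mk, slotPlaceScalar_mk]
  unfold boxType₀ boxType₁ pinTorusType₀ pinTorusType₁
  rw [archWeight_add, archWeight_add, archWeight_charArchType, archWeight_charArchType, mul_mul_mul_comm]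

include hpos₀ hpos₁ in
/-- the plane reads positive at `v₁` when both of its lines do (its two sign entries ARE `hpos₀`, `hpos₁`). -/
theorem cmXW_cmPlace_pos : ∀ j, 0 < cmXW (L : Type) (frameD V) (dW c.D) (dW_real c.D) ι₁ (HypCensus.cmPlace (L : Type) ι₁) j :=
  Fin.forall_fin_two.2 ⟨hpos₀, hpos₁⟩

include hpos₀ hpos₁ in
/-- **binder-2's `ι₁` torus scalar IS the slot place scalar**: `dIotaAt u = ι_{w(v₁)}(u₀) · ι_{w(v₁)}(u₁) = slotPlaceScalar u`
(binder-2's RUN-38 `HypCensus.dIotaAt` of `HypCensus/OmgInsIotaChoice`, positive reading — which `hpos₀ hpos₁` force). -/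
theorem dIotaAt_eq_slotPlaceScalar (u : NumberField.SeesawArchTorus (L : Type)) :
    HypCensus.dIotaAt (L : Type) (frameD V) (dW c.D) (dW_real c.D) ι₁ u = slotPlaceScalar (ι₁ := ι₁) u := by
  rw [HypCensus.dIotaAt, if_pos (cmXW_cmPlace_pos V c hpos₀ hpos₁)]; rfl

include hpos₀ hpos₁ in
/-- **THE TORUS IDENTITY, typed-weight form**: for every table `n`,
`archWeight (n − slotTypeVec 0) t₀ · archWeight (n − slotTypeVec 0) t₁ · χ_T(t₀,t₁) · slotPlaceScalar(t₀,t₁)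
  = archWeight n t₀ · archWeight (n + (slotTypeVec 1 − slotTypeVec 0)) t₁`. -/
theorem archWeight_pin_identity (n : InfinitePlace (L : Type) → ℤ)
    (t₀ t₁ : ↥(relNormOneInfUnits (↥(maximalRealSubfield (L : Type))) (L : Type))) :
    archWeight (L : Type) (n - slotTypeVec V c hGR hGR₀ hGR₁ hGR₂ hGR₃ h₁W 0) t₀ *
          archWeight (L : Type) (n - slotTypeVec V c hGR hGR₀ hGR₁ hGR₂ hGR₃ h₁W 0) t₁ *
        (((pinTorusChar V c.D hGR h₁W (NumberField.SeesawArchTorus.mk (L : Type) t₀ t₁) : Circle) : ℂ) *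
          slotPlaceScalar (ι₁ := ι₁) (NumberField.SeesawArchTorus.mk (L : Type) t₀ t₁)) =
      archWeight (L : Type) n t₀ *
        archWeight (L : Type) (n + (slotTypeVec V c hGR hGR₀ hGR₁ hGR₂ hGR₃ h₁W 1 - slotTypeVec V c hGR hGR₀ hGR₁ hGR₂ hGR₃ h₁W 0)) t₁ := by
  rw [pinTorusChar_mul_slotPlaceScalar, slotTypeVec_zero_eq_boxType₀ V c hGR hGR₀ hGR₁ hGR₂ hGR₃ h₁W hpos₀ hpos₁,
    slotTypeVec_one_eq_boxType₁ V c hGR hGR₀ hGR₁ hGR₂ hGR₃ h₁W hpos₀ hpos₁, mul_mul_mul_comm, ← archWeight_add, ← archWeight_add,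
    sub_add_cancel, sub_add_comm, add_comm]

end Pin

/-! ## §3 the η-factor at binder-2's torus element, Stage-B η -/

section Eta

variable
  (χV χW : ∀ {L : CMField} {ι₁ : L →+* ℂ} (_V : HermSpace3 L ι₁) (_c : SeesawCtx L),
    ContinuousMonoidHom (relNormOneIdeles (↥(maximalRealSubfield (L : Type))) (L : Type) ⧸
      relNormOneRat (↥(maximalRealSubfield (L : Type))) (L : Type)) Circle)
variable {L : CMField} {ι₁ : L →+* ℂ} (V : HermSpace3 L ι₁) (c : SeesawCtx L)

/-- **`η(1, diag(t₀,t₁)) = χW[t₀] · χW[t₁]`** at the Stage-B η `EtaChi.η χV χW` (the `V`-factor is `χV(det 1) = 1`; the `W`-factor is `χW ∘ det`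
at `diag(t₀,t₁)_𝔸 = archToAdelic (archDiag …)`, #1217 `cmPlaneTorusIdeles_inf_eq_archToAdelic`, sinst-1 `cmAdelicDet_cmPlaneTorus`). -/
theorem eta_archProdHom_one_archDiag (t₀ t₁ : ↥(relNormOneInfUnits (↥(maximalRealSubfield (L : Type))) (L : Type))) :
    ((EtaChi.η @χV @χW V c
        (archProdHom (↥(maximalRealSubfield (L : Type))) (L : Type) (IsCMField.complexConj (L : Type)) 3 2 (Matrix.diagonal (frameD V))
          (Matrix.diagonal (dW c.D))
          ((1 : ↥(UnitaryGroup.arch (↥(maximalRealSubfield (L : Type))) (L : Type) (IsCMField.complexConj (L : Type)) 3 (Matrix.diagonal (frameD V)))),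
            archDiag (L : Type) (dW c.D) (NumberField.SeesawArchTorus.mk (L : Type) t₀ t₁))) : ℂˣ) : ℂ) =
      unitaryLineCharInf (L : Type) (χW V c) t₀ * unitaryLineCharInf (L : Type) (χW V c) t₁ := by
  have h1 : (archProdHom (↥(maximalRealSubfield (L : Type))) (L : Type) (IsCMField.complexConj (L : Type)) 3 2 (Matrix.diagonal (frameD V))
      (Matrix.diagonal (dW c.D))
      ((1 : ↥(UnitaryGroup.arch (↥(maximalRealSubfield (L : Type))) (L : Type) (IsCMField.complexConj (L : Type)) 3 (Matrix.diagonal (frameD V)))),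
        archDiag (L : Type) (dW c.D) (NumberField.SeesawArchTorus.mk (L : Type) t₀ t₁))).1 = 1 :=
    map_one (archToAdelic (↥(maximalRealSubfield (L : Type))) (L : Type) (IsCMField.complexConj (L : Type)) 3 (Matrix.diagonal (frameD V)))
  have h2 : (archProdHom (↥(maximalRealSubfield (L : Type))) (L : Type) (IsCMField.complexConj (L : Type)) 3 2 (Matrix.diagonal (frameD V))
      (Matrix.diagonal (dW c.D))
      ((1 : ↥(UnitaryGroup.arch (↥(maximalRealSubfield (L : Type))) (L : Type) (IsCMField.complexConj (L : Type)) 3 (Matrix.diagonal (frameD V)))),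
        archDiag (L : Type) (dW c.D) (NumberField.SeesawArchTorus.mk (L : Type) t₀ t₁))).2 =
      archToAdelic (↥(maximalRealSubfield (L : Type))) (L : Type) (IsCMField.complexConj (L : Type)) 2 (Matrix.diagonal (dW c.D))
        (archDiag (L : Type) (dW c.D) (NumberField.SeesawArchTorus.mk (L : Type) t₀ t₁)) := rfl
  rw [EtaChi.η_apply, h1, h2, map_one, map_one, one_mul, ← cmPlaneTorusIdeles_inf_eq_archToAdelic, cmPlaneTorusIdeles_apply,
    cmAdelicDet_cmPlaneTorus, map_mul, Units.val_mul]
  rfl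

/-- the same with the typed weight of `χW`'s archimedean type. -/
theorem eta_archProdHom_one_archDiag_eq_archWeight (t₀ t₁ : ↥(relNormOneInfUnits (↥(maximalRealSubfield (L : Type))) (L : Type))) :
    ((EtaChi.η @χV @χW V c
        (archProdHom (↥(maximalRealSubfield (L : Type))) (L : Type) (IsCMField.complexConj (L : Type)) 3 2 (Matrix.diagonal (frameD V))
          (Matrix.diagonal (dW c.D))
          ((1 : ↥(UnitaryGroup.arch (↥(maximalRealSubfield (L : Type))) (L : Type) (IsCMField.complexConj (L : Type)) 3 (Matrix.diagonal (frameD V)))),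
            archDiag (L : Type) (dW c.D) (NumberField.SeesawArchTorus.mk (L : Type) t₀ t₁))) : ℂˣ) : ℂ) =
      archWeight (L : Type) (UnitaryLineChar.archType (L : Type) (χW V c)) t₀ *
        archWeight (L : Type) (UnitaryLineChar.archType (L : Type) (χW V c)) t₁ := by
  rw [eta_archProdHom_one_archDiag, unitaryLineCharInf_eq_archWeight]

variable
  (hGR : (cmSplittingDatum (L : Type) finProdFinEquiv (frameD V) (frameD_real V) (frameD_ne V) (dW c.D) (dW_real c.D) (dW_ne c.D)).CompatibleSplitting)
  (hGR₀ : (cmSplittingDatum (L : Type) (e₁) (frameD V) (frameD_real V) (frameD_ne V) (lineVec (L : Type) (dW c.D 0))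
    (fun _ => dW_real c.D 0) (fun _ => dW_ne c.D 0)).CompatibleSplitting)
  (hGR₁ : (cmSplittingDatum (L : Type) (e₁) (frameD V) (frameD_real V) (frameD_ne V) (lineVec (L : Type) (dW c.D 1))
    (fun _ => dW_real c.D 1) (fun _ => dW_ne c.D 1)).CompatibleSplitting)
  (hGR₂ : (cmSplittingDatum (L : Type) (e₁) (frameD V) (frameD_real V) (frameD_ne V) (lineVec (L : Type) (dW' c.D 0))
    (fun _ => dW'_real c.D 0) (fun _ => dW'_ne c.D 0)).CompatibleSplitting)
  (hGR₃ : (cmSplittingDatum (L : Type) (e₁) (frameD V) (frameD_real V) (frameD_ne V) (lineVec (L : Type) (dW' c.D 1))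
    (fun _ => dW'_real c.D 1) (fun _ => dW'_ne c.D 1)).CompatibleSplitting)
  (h₁W : (∀ j, 0 < (ι₁ (dW c.D j)).re) ∨ ∀ j, (ι₁ (dW c.D j)).re < 0)
  (hpos₀ : 0 < cmXW (L : Type) (frameD V) (lineVec (L : Type) (dW c.D 0)) (fun _ => dW_real c.D 0) ι₁ (HypCensus.cmPlace (L : Type) ι₁) 0)
  (hpos₁ : 0 < cmXW (L : Type) (frameD V) (lineVec (L : Type) (dW c.D 1)) (fun _ => dW_real c.D 1) ι₁ (HypCensus.cmPlace (L : Type) ι₁) 0)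

include hpos₀ hpos₁ in
/-- **binder-2's `hμ`, THETA SIDE**: at the Stage-B η with a W character of the slot-0 type `n − slotTypeVec … 0` (e.g. `χWR`, by
`archType_χOfType_nW`), for all `t₀ t₁`:
`η(1, diag(t₀,t₁)) · χ_T(t₀,t₁) · slotPlaceScalar(t₀,t₁) = archWeight n t₀ · archWeight (n + (slotTypeVec 1 − slotTypeVec 0)) t₁`. -/
theorem eta_pinTorusChar_slotPlaceScalar (n : InfinitePlace (L : Type) → ℤ)
    (hW : UnitaryLineChar.archType (L : Type) (χW V c) = n - slotTypeVec V c hGR hGR₀ hGR₁ hGR₂ hGR₃ h₁W 0)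
    (t₀ t₁ : ↥(relNormOneInfUnits (↥(maximalRealSubfield (L : Type))) (L : Type))) :
    ((EtaChi.η @χV @χW V c
        (archProdHom (↥(maximalRealSubfield (L : Type))) (L : Type) (IsCMField.complexConj (L : Type)) 3 2 (Matrix.diagonal (frameD V))
          (Matrix.diagonal (dW c.D))
          ((1 : ↥(UnitaryGroup.arch (↥(maximalRealSubfield (L : Type))) (L : Type) (IsCMField.complexConj (L : Type)) 3 (Matrix.diagonal (frameD V)))),
            archDiag (L : Type) (dW c.D) (NumberField.SeesawArchTorus.mk (L : Type) t₀ t₁))) : ℂˣ) : ℂ) *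
        ((pinTorusChar V c.D hGR h₁W (NumberField.SeesawArchTorus.mk (L : Type) t₀ t₁) : Circle) : ℂ) *
          slotPlaceScalar (ι₁ := ι₁) (NumberField.SeesawArchTorus.mk (L : Type) t₀ t₁) =
      archWeight (L : Type) n t₀ *
        archWeight (L : Type) (n + (slotTypeVec V c hGR hGR₀ hGR₁ hGR₂ hGR₃ h₁W 1 - slotTypeVec V c hGR hGR₀ hGR₁ hGR₂ hGR₃ h₁W 0)) t₁ := by
  rw [eta_archProdHom_one_archDiag_eq_archWeight, hW, mul_assoc]
  exact archWeight_pin_identity V c hGR hGR₀ hGR₁ hGR₂ hGR₃ h₁W hpos₀ hpos₁ n t₀ t₁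

include hpos₀ hpos₁ in
/-- **binder-2's `hμ`, THETA SIDE, in `hμ`'s own letters** (`dIotaAt`, any `u ∈ T(L⁺ ⊗ ℝ)`): with a W character of slot-0 type `n − slotTypeVec … 0`,
`η(1, diag u) · χ_T(u) · dIotaAt u = archWeight n u₀ · archWeight (n + (slotTypeVec 1 − slotTypeVec 0)) u₁`. -/
theorem eta_pinTorusChar_dIotaAt (n : InfinitePlace (L : Type) → ℤ)
    (hW : UnitaryLineChar.archType (L : Type) (χW V c) = n - slotTypeVec V c hGR hGR₀ hGR₁ hGR₂ hGR₃ h₁W 0)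
    (u : NumberField.SeesawArchTorus (L : Type)) :
    ((EtaChi.η @χV @χW V c
        (archProdHom (↥(maximalRealSubfield (L : Type))) (L : Type) (IsCMField.complexConj (L : Type)) 3 2 (Matrix.diagonal (frameD V))
          (Matrix.diagonal (dW c.D))
          ((1 : ↥(UnitaryGroup.arch (↥(maximalRealSubfield (L : Type))) (L : Type) (IsCMField.complexConj (L : Type)) 3 (Matrix.diagonal (frameD V)))),
            archDiag (L : Type) (dW c.D) u)) : ℂˣ) : ℂ) *
        ((pinTorusChar V c.D hGR h₁W u : Circle) : ℂ) * HypCensus.dIotaAt (L : Type) (frameD V) (dW c.D) (dW_real c.D) ι₁ u =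
      archWeight (L : Type) n (NumberField.SeesawArchTorus.fst (L : Type) u) *
        archWeight (L : Type) (n + (slotTypeVec V c hGR hGR₀ hGR₁ hGR₂ hGR₃ h₁W 1 - slotTypeVec V c hGR hGR₀ hGR₁ hGR₂ hGR₃ h₁W 0))
          (NumberField.SeesawArchTorus.snd (L : Type) u) := by
  rw [dIotaAt_eq_slotPlaceScalar V c hpos₀ hpos₁ u]
  exact eta_pinTorusChar_slotPlaceScalar χV χW V c hGR hGR₀ hGR₁ hGR₂ hGR₃ h₁W hpos₀ hpos₁ n hW
    (NumberField.SeesawArchTorus.fst (L : Type) u) (NumberField.SeesawArchTorus.snd (L : Type) u)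

end Eta

/-! ## §4 at E's pin of record: the OG guard, `χW := χWR (μ♯♯)`, exponents `μ♯♯ c 0`, `μ♯♯ c 1` -/

section GOG

variable
  (hGR : ∀ {L : CMField} {ι₁ : L →+* ℂ} (V : HermSpace3 L ι₁) (c : SeesawCtx L),
    (cmSplittingDatum (L : Type) finProdFinEquiv (frameD V) (frameD_real V) (frameD_ne V) (dW c.D) (dW_real c.D)
      (dW_ne c.D)).CompatibleSplitting)
  (χV : ∀ {L : CMField} {ι₁ : L →+* ℂ} (_V : HermSpace3 L ι₁) (_c : SeesawCtx L),
    ContinuousMonoidHom (relNormOneIdeles (↥(maximalRealSubfield (L : Type))) (L : Type) ⧸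
      relNormOneRat (↥(maximalRealSubfield (L : Type))) (L : Type)) Circle)
  (hGR₀ : ∀ {L : CMField} {ι₁ : L →+* ℂ} (V : HermSpace3 L ι₁) (c : SeesawCtx L),
    (cmSplittingDatum (L : Type) (e₁) (frameD V) (frameD_real V) (frameD_ne V) (lineVec (L : Type) (dW c.D 0))
      (fun _ => dW_real c.D 0) (fun _ => dW_ne c.D 0)).CompatibleSplitting)
  (hGR₁ : ∀ {L : CMField} {ι₁ : L →+* ℂ} (V : HermSpace3 L ι₁) (c : SeesawCtx L),
    (cmSplittingDatum (L : Type) (e₁) (frameD V) (frameD_real V) (frameD_ne V) (lineVec (L : Type) (dW c.D 1))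
      (fun _ => dW_real c.D 1) (fun _ => dW_ne c.D 1)).CompatibleSplitting)
  (hGR₂ : ∀ {L : CMField} {ι₁ : L →+* ℂ} (V : HermSpace3 L ι₁) (c : SeesawCtx L),
    (cmSplittingDatum (L : Type) (e₁) (frameD V) (frameD_real V) (frameD_ne V) (lineVec (L : Type) (dW' c.D 0))
      (fun _ => dW'_real c.D 0) (fun _ => dW'_ne c.D 0)).CompatibleSplitting)
  (hGR₃ : ∀ {L : CMField} {ι₁ : L →+* ℂ} (V : HermSpace3 L ι₁) (c : SeesawCtx L),
    (cmSplittingDatum (L : Type) (e₁) (frameD V) (frameD_real V) (frameD_ne V) (lineVec (L : Type) (dW' c.D 1))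
      (fun _ => dW'_real c.D 1) (fun _ => dW'_ne c.D 1)).CompatibleSplitting)
  (μ : ∀ {L : CMField}, SeesawCtx L → Fin 4 → NumberField.InfinitePlace L → ℤ)

include hGR₂ hGR₃ in
/-- **binder-2's `hμ`, THETA SIDE, AT E's PIN OF RECORD** (OG guard `SInstance.GOG`; Stage-B η with `χW := SInstance.χWR … (μ♯♯)`, the W character
of the `_r21AEOGIS…` chain at theta-3's (K10) adapter `μ♯♯ = muSharp₂₃ μ`): for every guarded `(V, c)` and all `t₀ t₁`,
`η(1, diag(t₀,t₁)) · χ_T(t₀,t₁) · ι_{w(v₁)}(t₀) ι_{w(v₁)}(t₁) = archWeight (μ♯♯ c 0) t₀ · archWeight (μ♯♯ c 1) t₁`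
— the inverse of the printed torus weight with exponents `−μ♯♯ c 0`, `−μ♯♯ c 1` (glue-1's #398S `printedAt … (fun w => -(μ♯♯) c 0 w) (fun w => -(μ♯♯) c 1 w)`).
(The slot-2/3 splitting families `hGR₂ hGR₃` enter only through `slotTypeVec`'s packaging of all four slots.) -/
theorem eta_pinTorusChar_slotPlaceScalar_GOG {L : CMField} {ι₁ : L →+* ℂ} (V : HermSpace3 L ι₁) (c : SeesawCtx L) (hc : SInstance.GOG V c)
    (t₀ t₁ : ↥(relNormOneInfUnits (↥(maximalRealSubfield (L : Type))) (L : Type))) :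
    ((EtaChi.η @χV (@SInstance.χWR @hGR @hGR₀ @hGR₁ (muSharp₂₃ @μ)) V c
        (archProdHom (↥(maximalRealSubfield (L : Type))) (L : Type) (IsCMField.complexConj (L : Type)) 3 2 (Matrix.diagonal (frameD V))
          (Matrix.diagonal (dW c.D))
          ((1 : ↥(UnitaryGroup.arch (↥(maximalRealSubfield (L : Type))) (L : Type) (IsCMField.complexConj (L : Type)) 3 (Matrix.diagonal (frameD V)))),
            archDiag (L : Type) (dW c.D) (NumberField.SeesawArchTorus.mk (L : Type) t₀ t₁))) : ℂˣ) : ℂ) *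
        ((pinTorusChar V c.D (hGR V c) (SInstance.hG_GOG V c hc) (NumberField.SeesawArchTorus.mk (L : Type) t₀ t₁) : Circle) : ℂ) *
          slotPlaceScalar (ι₁ := ι₁) (NumberField.SeesawArchTorus.mk (L : Type) t₀ t₁) =
      archWeight (L : Type) (muSharp₂₃ μ c 0) t₀ * archWeight (L : Type) (muSharp₂₃ μ c 1) t₁ := by
  rw [eta_pinTorusChar_slotPlaceScalar χV (@SInstance.χWR @hGR @hGR₀ @hGR₁ (muSharp₂₃ @μ)) V c (hGR V c) (hGR₀ V c) (hGR₁ V c)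
      (hGR₂ V c) (hGR₃ V c) (SInstance.hG_GOG V c hc) (SInstance.hpos_GOG V c hc).1 (SInstance.hpos_GOG V c hc).2.1 (muSharp₂₃ μ c 0)
      (SInstance.archType_χOfType_nW @SInstance.GOG @SInstance.hG_GOG @hGR @hGR₀ @hGR₁ @hGR₂ @hGR₃ (muSharp₂₃ @μ) V c hc) t₀ t₁,
    hΔ₁_GOG_muSharp hGR hGR₀ hGR₁ hGR₂ hGR₃ μ V c hc, muSharp_one_sub_zero, ← muSharp₂₃_one_sub_zero μ c, add_sub_cancel]

include hGR₂ hGR₃ in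
/-- **binder-2's `hμ`, THETA SIDE, AT E's PIN OF RECORD, in `hμ`'s own letters** (OG guard, `χW := χWR … (μ♯♯)`, any `u ∈ T(L⁺ ⊗ ℝ)`):
`η(1, diag u) · χ_T(u) · dIotaAt u = archWeight (μ♯♯ c 0) u₀ · archWeight (μ♯♯ c 1) u₁` — so at `u := archOf … t` the hypothesis `hμ` of
`HypCensus.omgW_ins_vacuum_datumAt_eq_of_weight` ∕ (T12) `omgW_ins_eq_of_weight` reads
`archWeight (μ♯♯ c 0) (fst (archOf … t)) · archWeight (μ♯♯ c 1) (snd (archOf … t)) = (printPlacesW … t)⁻¹` (binder-2's printed side only). -/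
theorem eta_pinTorusChar_dIotaAt_GOG {L : CMField} {ι₁ : L →+* ℂ} (V : HermSpace3 L ι₁) (c : SeesawCtx L) (hc : SInstance.GOG V c)
    (u : NumberField.SeesawArchTorus (L : Type)) :
    ((EtaChi.η @χV (@SInstance.χWR @hGR @hGR₀ @hGR₁ (muSharp₂₃ @μ)) V c
        (archProdHom (↥(maximalRealSubfield (L : Type))) (L : Type) (IsCMField.complexConj (L : Type)) 3 2 (Matrix.diagonal (frameD V))
          (Matrix.diagonal (dW c.D))
          ((1 : ↥(UnitaryGroup.arch (↥(maximalRealSubfield (L : Type))) (L : Type) (IsCMField.complexConj (L : Type)) 3 (Matrix.diagonal (frameD V)))),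
            archDiag (L : Type) (dW c.D) u)) : ℂˣ) : ℂ) *
        ((pinTorusChar V c.D (hGR V c) (SInstance.hG_GOG V c hc) u : Circle) : ℂ) *
          HypCensus.dIotaAt (L : Type) (frameD V) (dW c.D) (dW_real c.D) ι₁ u =
      archWeight (L : Type) (muSharp₂₃ μ c 0) (NumberField.SeesawArchTorus.fst (L : Type) u) *
        archWeight (L : Type) (muSharp₂₃ μ c 1) (NumberField.SeesawArchTorus.snd (L : Type) u) := by
  rw [dIotaAt_eq_slotPlaceScalar V c (SInstance.hpos_GOG V c hc).1 (SInstance.hpos_GOG V c hc).2.1 u]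
  exact eta_pinTorusChar_slotPlaceScalar_GOG hGR χV hGR₀ hGR₁ hGR₂ hGR₃ μ V c hc (NumberField.SeesawArchTorus.fst (L : Type) u)
    (NumberField.SeesawArchTorus.snd (L : Type) u)

end GOG

end HodgeCM.Model.ArchSideTerm

end
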